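import Summits.CriticalPhenomena.SAWScalingLimit.Theorems.SAWDefectDecoherenceBoundaryClosureRZigzagHalfLattice
import HarnessLib

/-!
# Crux `BoundaryClosureR` (stmt-CriticalPhenomena-14004), line `polygon-parity-squeeze`,
# stub `stub_innerPolygons` (IP): the trimmed discretisation of a zigzag half-plane is an
# EXACT half-lattice (level dictionary of the six forms)

Landing target:
`Summits/CriticalPhenomena/SAWScalingLimit/Theorems/SAWDefectDecoherenceBoundaryClosureRInnerPolygonsHalfLattice.lean`
(`--supports stmt-CriticalPhenomena-14004`; building block of the registered stub `stub_innerPolygons`,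
hypothesis (IP) of the landed squeeze `PolygonParitySqueeze.squeeze_of_innerPolygons`).

The inner exact polygon family `Λ^P_δ` of the squeeze is obtained from a zigzag-direction polygon `P`
by TRIMMED discretisation: along a side of `P` of form `k : Fin 6` (line `Re((w - z)·conj n_k) = 0`,
inner normal `n_k = innerNormal k`) one keeps the faces `v` with `n ≤ zigzagForm k v` for the least
threshold `n` all of whose faces lie strictly inside the open half-plane `halfPlane k z`.  This file
proves that this rounding is EXACT and loses at most a layer of width `δ√3/6 < δ/2`:

* `norm_innerNormal` — the six inner normals are unit vectors;
* `level_eq` — **the level dictionary**: in the frame of form `k`, the level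
  `Re(c_v · conj n_k)` of the centre of the face `v` is `(√3/6)·(3·zigzagForm k v + (-1)^k j)` with
  `j ∈ {1, 2}` (the two face types of one zigzag row sit at two levels `√3/6` apart); whence the
  two-sided bounds `level_ge`, `level_le` and strict monotonicity of the level in the form
  (`level_lt_of_zigzagForm_lt`);
* `exists_exact_threshold` — **exact rounding**: for every form `k`, base point `z` and mesh
  `δ > 0` there is a threshold `n : ℤ` such that every face with `n ≤ zigzagForm k v` has its scaled
  centre `δ c_v` strictly inside `halfPlane k z`, and conversely every face whose scaled centre lies
  inside at signed distance `> δ√3/6` from the boundary line satisfies `n ≤ zigzagForm k v`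
  (`exists_exact_threshold_half`: the same with the rounder margin `δ/2`);
* `exists_exact_corner_thresholds` — the same at a lattice corner (two forms: the convex corner
  lattice `{n ≤ f_k ∧ n' ≤ f_k'}` and the reflex one `{n ≤ f_k ∨ n' ≤ f_k'}`, lattice half of
  `IsCornerAt`);
* `mem_halfPlane_iff_level`, `signedLevel_smul_sub`, `abs_level_le_dist`,
  `ball_subset_halfPlane_of_level`, `level_ge_of_ball_subset` — bookkeeping between `halfPlane`,
  signed levels, balls and scaling (an `s`-ball lies in the half-plane iff its centre has level `≥ s`).

Sources: H. Duminil-Copin, S. Smirnov, Ann. of Math. 175 (2012) §2 (domains of the hexagonal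
lattice); the line card `Cruxes/BoundaryClosureR/Lines/polygon-parity-squeeze.md` (exact-sided
lattice polygons).  No definition and no named fact is introduced.
-/

noncomputable section

open scoped ComplexConjugate
open Literature.Probability.LatticeModels
open Literature.Probability.Percolation (hexCenter_im hexCenter_re)

namespace Summit.CriticalPhenomena.SAWScalingLimit.Theorems.PolygonParitySqueeze

/-! ### 1. Unit normals, half-planes and levels -/

/-- `(√3/2)² + (1/2)² = 1`. [folklore] -/
theorem sqrt_three_div_two_sq_add : (Real.sqrt 3 / 2) ^ 2 + (1 / 2 : ℝ) ^ 2 = 1 := by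
  have h3 : Real.sqrt 3 ^ 2 = 3 := Real.sq_sqrt (by norm_num)
  nlinarith [h3]

/-- **The six inner normals are unit vectors.** [folklore] -/
theorem norm_innerNormal (k : Fin 6) : ‖innerNormal k‖ = 1 := by
  have h := sqrt_three_div_two_sq_add
  have key : ∀ w : ℂ, w.re ^ 2 + w.im ^ 2 = 1 → ‖w‖ = 1 := fun w hw => by
    rw [Complex.norm_eq_sqrt_sq_add_sq, hw, Real.sqrt_one]
  fin_cases k <;> apply key <;> simp [innerNormal_eq] <;> nlinarith [h]

/-- Membership in the half-plane of form `k` through `z` is positivity of the signed level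
`Re((w - z)·conj n_k)`. [folklore] -/
theorem mem_halfPlane_iff_level (k : Fin 6) (z w : ℂ) :
    w ∈ halfPlane k z ↔ 0 < ((w - z) * conj (innerNormal k)).re := Iff.rfl

/-- The signed level of a scaled centre: `Re((δ c - z)·conj n) = δ·Re(c·conj n) - Re(z·conj n)`.
[folklore] -/
theorem signedLevel_smul_sub (δ : ℝ) (c z n : ℂ) :
    (((δ : ℂ) * c - z) * conj n).re = δ * (c * conj n).re - (z * conj n).re := by
  simp only [sub_mul, Complex.sub_re, mul_assoc, Complex.re_ofReal_mul]

/-- The signed level is `1`-Lipschitz: `|Re((w - z)·conj n_k)| ≤ dist w z` (the normals are unit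
vectors), so a point at signed level `> s` has its whole `s`-ball on the positive side. [folklore] -/
theorem abs_level_le_dist (k : Fin 6) (z w : ℂ) :
    |((w - z) * conj (innerNormal k)).re| ≤ dist w z := by
  calc |((w - z) * conj (innerNormal k)).re| ≤ ‖(w - z) * conj (innerNormal k)‖ :=
        Complex.abs_re_le_norm _
    _ = dist w z := by
        rw [norm_mul, Complex.norm_conj, norm_innerNormal, mul_one, Complex.dist_eq]

/-- A ball about a point of signed level `≥ s` lies in the half-plane once its radius is `≤ s`.
[folklore] -/
theorem ball_subset_halfPlane_of_level (k : Fin 6) (z w : ℂ) (s : ℝ)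
    (hw : s ≤ ((w - z) * conj (innerNormal k)).re) : Metric.ball w s ⊆ halfPlane k z := by
  intro y hy
  rw [mem_halfPlane_iff_level]
  have h1 := abs_level_le_dist k w y
  have h2 : ((y - z) * conj (innerNormal k)).re =
      ((y - w) * conj (innerNormal k)).re + ((w - z) * conj (innerNormal k)).re := by
    rw [← Complex.add_re, ← add_mul, sub_add_sub_cancel]
  rw [Metric.mem_ball] at hy
  rw [h2]
  have := neg_abs_le ((y - w) * conj (innerNormal k)).re
  linarith

/-- `n_k · conj n_k = 1` (real part), the normals being unit vectors. [folklore] -/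
theorem re_innerNormal_mul_conj (k : Fin 6) : (innerNormal k * conj (innerNormal k)).re = 1 := by
  rw [Complex.mul_conj, Complex.ofReal_re, Complex.normSq_eq_norm_sq, norm_innerNormal, one_pow]

/-- **Balls inside the half-plane sit at level at least their radius**: if `ball w s ⊆ halfPlane k z`
with `s > 0` then the signed level of `w` is `≥ s` (otherwise `w - t·n_k` for a suitable
`t < s` lies in the ball but not in the half-plane).  Converse of `ball_subset_halfPlane_of_level`;
this is how "`η`-deep" faces (`η ≤ infDist`) are shown to pass the exact thresholds. [folklore] -/
theorem level_ge_of_ball_subset (k : Fin 6) (z w : ℂ) (s : ℝ) (hs : 0 < s)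
    (h : Metric.ball w s ⊆ halfPlane k z) : s ≤ ((w - z) * conj (innerNormal k)).re := by
  by_contra hlt
  push Not at hlt
  set ℓ := ((w - z) * conj (innerNormal k)).re with hℓ
  set t : ℝ := (max ℓ 0 + s) / 2 with ht
  have hmax : max ℓ 0 < s := max_lt hlt hs
  have ht1 : max ℓ 0 < t := by rw [ht]; linarith
  have ht2 : t < s := by rw [ht]; linarith
  have ht0 : 0 < t := lt_of_le_of_lt (le_max_right _ _) ht1
  have hmem : w - (t : ℂ) * innerNormal k ∈ Metric.ball w s := by
    rw [Metric.mem_ball, dist_eq_norm, sub_sub_cancel_left, norm_neg, norm_mul, norm_innerNormal,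
      mul_one, Complex.norm_real, Real.norm_of_nonneg ht0.le]
    exact ht2
  have hpos := (mem_halfPlane_iff_level k z _).1 (h hmem)
  have hcalc : ((w - (t : ℂ) * innerNormal k - z) * conj (innerNormal k)).re = ℓ - t := by
    have : (w - (t : ℂ) * innerNormal k - z) * conj (innerNormal k) =
        (w - z) * conj (innerNormal k) - (t : ℂ) * (innerNormal k * conj (innerNormal k)) := by ring
    rw [this, Complex.sub_re, Complex.re_ofReal_mul, re_innerNormal_mul_conj, mul_one]
  rw [hcalc] at hpos
  have : ℓ ≤ max ℓ 0 := le_max_left _ _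
  linarith

/-! ### 2. The level dictionary of the six forms -/

/-- **The level dictionary** (all six forms): the level `Re(c_v · conj n_k)` of the centre of the
face `v` in the frame of form `k` is `(√3/6)·(3·zigzagForm k v + (-1)^k·j)` with `j = 1` or `j = 2`
(for the forms `0, 2, 4` the two face types of a row sit `√3/6` resp. `√3/3` above the row line
`level = (√3/2)·n`; for the forms `1, 3, 5` below it).  In particular the form is a monotone function
of the level, as asserted in the docstring of `innerNormal`. [folklore] -/
theorem level_eq (k : Fin 6) (v : HexVertex) : ∃ j : ℤ, (j = 1 ∨ j = 2) ∧
    (hexCenter v * conj (innerNormal k)).re =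
      Real.sqrt 3 / 6 * (3 * (zigzagForm k v : ℝ) + (-1 : ℝ) ^ (k : ℕ) * (j : ℝ)) := by
  obtain ⟨x, t⟩ := v
  fin_cases k <;> fin_cases t
  all_goals
    first
    | (refine ⟨1, Or.inl rfl, ?_⟩
       simp [innerNormal_eq, zigzagForm, Complex.mul_re, hexCenter_re, hexCenter_im]
       ring_nf
       done)
    | (refine ⟨2, Or.inr rfl, ?_⟩
       simp [innerNormal_eq, zigzagForm, Complex.mul_re, hexCenter_re, hexCenter_im]
       ring_nf)

/-- The sign `(-1)^k` of the form `k` is `±1`. [folklore] -/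
theorem neg_one_pow_fin_six (k : Fin 6) : (-1 : ℝ) ^ (k : ℕ) = 1 ∨ (-1 : ℝ) ^ (k : ℕ) = -1 :=
  neg_one_pow_eq_or ℝ (k : ℕ)

/-- **Lower level bound**: `(√3/6)·(3·zigzagForm k v + (3(-1)^k - 1)/2) ≤ Re(c_v · conj n_k)` (the
lower of the two levels of the row of `v`). [folklore] -/
theorem level_ge (k : Fin 6) (v : HexVertex) :
    Real.sqrt 3 / 6 * (3 * (zigzagForm k v : ℝ) + (3 * (-1 : ℝ) ^ (k : ℕ) - 1) / 2) ≤
      (hexCenter v * conj (innerNormal k)).re := by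
  obtain ⟨j, hj, h⟩ := level_eq k v
  rw [h]
  have h3 : 0 < Real.sqrt 3 := Real.sqrt_pos.2 (by norm_num)
  rcases hj with rfl | rfl <;> rcases neg_one_pow_fin_six k with hs | hs <;> rw [hs] <;>
    push_cast <;> nlinarith

/-- **Upper level bound**: `Re(c_v · conj n_k) ≤ (√3/6)·(3·zigzagForm k v + (3(-1)^k + 1)/2)` (the
upper of the two levels of the row of `v`). [folklore] -/
theorem level_le (k : Fin 6) (v : HexVertex) :
    (hexCenter v * conj (innerNormal k)).re ≤
      Real.sqrt 3 / 6 * (3 * (zigzagForm k v : ℝ) + (3 * (-1 : ℝ) ^ (k : ℕ) + 1) / 2) := by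
  obtain ⟨j, hj, h⟩ := level_eq k v
  rw [h]
  have h3 : 0 < Real.sqrt 3 := Real.sqrt_pos.2 (by norm_num)
  rcases hj with rfl | rfl <;> rcases neg_one_pow_fin_six k with hs | hs <;> rw [hs] <;>
    push_cast <;> nlinarith

/-- **The level is strictly increasing in the form**: faces of a higher zigzag row sit at least
`√3/3` higher in the frame of the form. [folklore] -/
theorem level_lt_of_zigzagForm_lt (k : Fin 6) (v w : HexVertex) (h : zigzagForm k v < zigzagForm k w) :
    (hexCenter v * conj (innerNormal k)).re + Real.sqrt 3 / 3 ≤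
      (hexCenter w * conj (innerNormal k)).re := by
  have hv := level_le k v
  have hw := level_ge k w
  have h' : (zigzagForm k v : ℝ) + 1 ≤ zigzagForm k w := by exact_mod_cast h
  have h3 : 0 < Real.sqrt 3 := Real.sqrt_pos.2 (by norm_num)
  nlinarith

/-! ### 3. Exact rounding: the trimmed discretisation of a half-plane is an exact half-lattice -/

/-- **Exact rounding of a zigzag half-plane** (the lattice half of `IsFlatSideAt` for the inner
polygon family).  For every form `k`, base point `z` and mesh `δ > 0` there is a threshold `n : ℤ`
with: (i) every face `v` with `n ≤ zigzagForm k v` has its scaled centre `δ·c_v` strictly inside the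
open half-plane `halfPlane k z`; (ii) every face whose scaled centre has signed level
`Re((δ c_v - z)·conj n_k) > δ√3/6` satisfies `n ≤ zigzagForm k v`.  So the exact half-lattice
`{v | n ≤ zigzagForm k v}` and the naive discretisation `{v | δ c_v ∈ halfPlane k z}` differ only in
a boundary layer of width `δ√3/6`; `n` is the least threshold all of whose faces lie strictly
inside (`n = ⌊(2√3·Re(z·conj n_k)/δ - m_k)/3⌋ + 1`, `m_k = (3(-1)^k - 1)/2`). [folklore] -/
theorem exists_exact_threshold : ∀ (k : Fin 6) (z : ℂ) (δ : ℝ), 0 < δ → ∃ n : ℤ, ∀ v : HexVertex, (n ≤ zigzagForm k v → (δ : ℂ) * hexCenter v ∈ halfPlane k z) ∧ (δ * (Real.sqrt 3 / 6) < (((δ : ℂ) * hexCenter v - z) * (starRingEnd ℂ) (innerNormal k)).re → n ≤ zigzagForm k v) := by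
  intro k z δ hδ
  set m : ℝ := (3 * (-1 : ℝ) ^ (k : ℕ) - 1) / 2 with hm
  set L : ℝ := (z * conj (innerNormal k)).re with hL
  set A : ℝ := 2 * Real.sqrt 3 * L / δ with hA
  have h3 : Real.sqrt 3 * Real.sqrt 3 = 3 := Real.mul_self_sqrt (by norm_num)
  have h3p : 0 < Real.sqrt 3 := Real.sqrt_pos.2 (by norm_num)
  have hfl1 : (A - m) / 3 < (⌊(A - m) / 3⌋ : ℝ) + 1 := Int.lt_floor_add_one _
  have hfl2 : (⌊(A - m) / 3⌋ : ℝ) ≤ (A - m) / 3 := Int.floor_le _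
  refine ⟨⌊(A - m) / 3⌋ + 1, fun v => ⟨fun hf => ?_, fun hlev => ?_⟩⟩
  · -- (i) faces above the threshold are strictly inside
    have hf' : ((⌊(A - m) / 3⌋ + 1 : ℤ) : ℝ) ≤ zigzagForm k v := by exact_mod_cast hf
    push_cast at hf'
    have hge := level_ge k v
    rw [mem_halfPlane_iff_level, signedLevel_smul_sub]
    -- `A < 3n + m`, i.e. `2√3 L < (3n + m) δ`
    have hA1 : 2 * Real.sqrt 3 * L < (3 * ((⌊(A - m) / 3⌋ : ℝ) + 1) + m) * δ := by
      rw [← div_lt_iff₀ hδ]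
      linarith
    have h1 : δ * (Real.sqrt 3 / 6 * (3 * ((⌊(A - m) / 3⌋ : ℝ) + 1) + m)) ≤
        δ * (hexCenter v * conj (innerNormal k)).re := by
      apply mul_le_mul_of_nonneg_left _ hδ.le
      refine le_trans ?_ hge
      rw [← hm]
      nlinarith
    have h2 : L < δ * (Real.sqrt 3 / 6 * (3 * ((⌊(A - m) / 3⌋ : ℝ) + 1) + m)) := by
      have : Real.sqrt 3 / 6 * (2 * Real.sqrt 3 * L) = L := by linear_combination (L / 3) * h3
      nlinarith
    rw [← hL]
    linarith
  · -- (ii) faces deeper than `δ√3/6` are above the threshold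
    by_contra hf
    have hf1 : zigzagForm k v ≤ ⌊(A - m) / 3⌋ := by omega
    have hf' : (zigzagForm k v : ℝ) ≤ (⌊(A - m) / 3⌋ : ℝ) := by exact_mod_cast hf1
    have hle := level_le k v
    rw [signedLevel_smul_sub, ← hL] at hlev
    -- `3(n-1) + m ≤ A`, i.e. `(3(n-1) + m) δ ≤ 2√3 L`
    have hA2 : (3 * (⌊(A - m) / 3⌋ : ℝ) + m) * δ ≤ 2 * Real.sqrt 3 * L := by
      rw [← le_div_iff₀ hδ]
      linarith
    have h1 : δ * (hexCenter v * conj (innerNormal k)).re ≤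
        δ * (Real.sqrt 3 / 6 * (3 * (⌊(A - m) / 3⌋ : ℝ) + m + 1)) := by
      apply mul_le_mul_of_nonneg_left _ hδ.le
      refine hle.trans ?_
      have hm1 : (3 * (-1 : ℝ) ^ (k : ℕ) + 1) / 2 = m + 1 := by rw [hm]; ring
      rw [hm1]
      nlinarith
    have h2 : δ * (Real.sqrt 3 / 6 * (3 * (⌊(A - m) / 3⌋ : ℝ) + m + 1)) ≤
        L + δ * (Real.sqrt 3 / 6) := by
      have : Real.sqrt 3 / 6 * (2 * Real.sqrt 3 * L) = L := by linear_combination (L / 3) * h3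
      nlinarith
    linarith

/-- `√3/6 < 1/2`. [folklore] -/
theorem sqrt_three_div_six_lt_half : Real.sqrt 3 / 6 < 1 / 2 := by
  have h : Real.sqrt 3 < 2 := by
    rw [show (2 : ℝ) = Real.sqrt 4 by rw [show (4 : ℝ) = 2 ^ 2 by norm_num, Real.sqrt_sq (by norm_num)]]
    exact Real.sqrt_lt_sqrt (by norm_num) (by norm_num)
  linarith

/-- **Exact rounding, margin `δ/2`**: the same threshold with the rounder sufficient condition
"signed level `≥ δ/2`" for (ii) (since `√3/6 < 1/2`). [folklore] -/
theorem exists_exact_threshold_half : ∀ (k : Fin 6) (z : ℂ) (δ : ℝ), 0 < δ → ∃ n : ℤ, ∀ v : HexVertex, (n ≤ zigzagForm k v → (δ : ℂ) * hexCenter v ∈ halfPlane k z) ∧ (δ / 2 ≤ (((δ : ℂ) * hexCenter v - z) * (starRingEnd ℂ) (innerNormal k)).re → n ≤ zigzagForm k v) := by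
  intro k z δ hδ
  obtain ⟨n, hn⟩ := exists_exact_threshold k z δ hδ
  refine ⟨n, fun v => ⟨(hn v).1, fun h => (hn v).2 (lt_of_lt_of_le ?_ h)⟩⟩
  have := sqrt_three_div_six_lt_half
  nlinarith

/-- **Exact rounding, ball form** (how `IsFlatSideAt` consumes it): with the threshold `n` of
`exists_exact_threshold`, a face whose scaled centre carries a ball of radius `δ/2` inside the
half-plane... equivalently whose signed level is `≥ δ/2`, lies in the exact half-lattice; and every
face of the exact half-lattice has its scaled centre in the half-plane.  Uniqueness: any two
thresholds with property (i)–(ii) coincide as soon as some face has signed level in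
`(δ√3/6, ∞)` at each of them — not needed by the line and not recorded. [folklore] -/
theorem exact_threshold_mono : ∀ (k : Fin 6) (n : ℤ) (v w : HexVertex), n ≤ zigzagForm k v → (hexCenter v * (starRingEnd ℂ) (innerNormal k)).re ≤ (hexCenter w * (starRingEnd ℂ) (innerNormal k)).re → n ≤ zigzagForm k w := by
  intro k n v w hv hle
  by_contra hw
  have hlt : zigzagForm k w < zigzagForm k v := by omega
  have := level_lt_of_zigzagForm_lt k w v hlt
  have h3 : 0 < Real.sqrt 3 := Real.sqrt_pos.2 (by norm_num)
  linarith

/-- **Exact rounding at a lattice corner** (lattice half of `IsCornerAt` for the inner polygon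
family): for two forms `k, k'`, a corner point `z` and a mesh `δ > 0`, the two thresholds `n, n'` of
`exists_exact_threshold` make the CONVEX corner lattice `{n ≤ f_k ∧ n' ≤ f_k'}` sit inside
`halfPlane k z ∩ halfPlane k' z` and the REFLEX corner lattice `{n ≤ f_k ∨ n' ≤ f_k'}` inside
`halfPlane k z ∪ halfPlane k' z`, while every face at signed level `≥ δ/2` from the line of form `k`
(resp. `k'`) passes the threshold `n` (resp. `n'`). [folklore] -/
theorem exists_exact_corner_thresholds : ∀ (k k' : Fin 6) (z : ℂ) (δ : ℝ), 0 < δ → ∃ n n' : ℤ, ∀ v : HexVertex, ((n ≤ zigzagForm k v ∧ n' ≤ zigzagForm k' v) → (δ : ℂ) * hexCenter v ∈ halfPlane k z ∩ halfPlane k' z) ∧ ((n ≤ zigzagForm k v ∨ n' ≤ zigzagForm k' v) → (δ : ℂ) * hexCenter v ∈ halfPlane k z ∪ halfPlane k' z) ∧ (δ / 2 ≤ (((δ : ℂ) * hexCenter v - z) * (starRingEnd ℂ) (innerNormal k)).re → n ≤ zigzagForm k v) ∧ (δ / 2 ≤ (((δ : ℂ) * hexCenter v - z) * (starRingEnd ℂ)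 (innerNormal k')).re → n' ≤ zigzagForm k' v) := by
  intro k k' z δ hδ
  obtain ⟨n, hn⟩ := exists_exact_threshold_half k z δ hδ
  obtain ⟨n', hn'⟩ := exists_exact_threshold_half k' z δ hδ
  refine ⟨n, n', fun v => ⟨fun h => ⟨(hn v).1 h.1, (hn' v).1 h.2⟩, fun h => ?_, (hn v).2, (hn' v).2⟩⟩
  rcases h with h | h
  · exact Or.inl ((hn v).1 h)
  · exact Or.inr ((hn' v).1 h)

end Summit.CriticalPhenomena.SAWScalingLimit.Theorems.PolygonParitySqueeze

end
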